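import Mathlib
import Literature.Analysis.FluidPDE.ClassicalSolution
import Literature.Analysis.FluidPDE.LerayHopf
import Literature.Analysis.FluidPDE.NSWave0
import Summits.NavierStokesRegularity.NavierStokesRegularity.Theses.L3TimeExponentPincer
import HarnessLib.Audit
import HarnessLib

/-!
# Stub `stub_floorToDivergence` of line `RateFloor` (crux `SupercriticalSerrinL3`, route `L3TimeExponentPincer`) — CLOSED

The registered M-stub of the skeleton of `stmt-NavierStokesRegularity-19500` (the route's declared RESIDUAL conjunct;
skeleton = BC3 birth skeleton of cell ns-regularity-ideate seat p2, ported and registered by seat p4), proved BY NAME with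
its registered signature: a power-law floor `‖u(t)‖₃ ≥ c (T-t)^{-θ₀}` on a final window with `q θ₀ ≥ 1` (`q ≥ 0`, `c > 0`)
makes the window integral `∫_{T₂}^{T} ‖u(t)‖₃^q dt` INFINITE on every final window `(T₂, T)`.  Pure real analysis:
`(c (T-t)^{-θ₀})^q = c^q (T-t)^{-qθ₀}` and `∫_a^T (T-t)^{-s} dt = ∞` for `s ≥ 1`
(`lintegral_Ioo_ofReal_rpow_neg_eq_top`, from Mathlib's `intervalIntegral.integrableOn_Ioo_rpow_iff`).

WHAT THIS IS NOT: not a claim about Navier–Stokes; the open content of the line is the other stub (`stub_l3RateFloor`,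
a power-law ESS floor with exponent `> 1/5`, hard-core-strength).
-/

noncomputable section

namespace Summit.NavierStokesRegularity.NavierStokesRegularity.Cruxes.SupercriticalSerrinL3.RateFloor

open scoped ENNReal NNReal Topology
open MeasureTheory Set Filter Literature.Analysis.FluidPDE

/-- `∫⁻_{(a,T)} (T-t)^{-s} dt = ∞` for `a < T` and `s ≥ 1` (reflection `t ↦ T - t` of the non-integrability of `x^{-s}`
at `0⁺`, `intervalIntegral.integrableOn_Ioo_rpow_iff`). -/
theorem lintegral_Ioo_ofReal_rpow_neg_eq_top {a T s : ℝ} (haT : a < T) (hs : 1 ≤ s) :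
    (∫⁻ t in Ioo a T, ENNReal.ofReal ((T - t) ^ (-s))) = ⊤ := by
  by_contra hne
  have hlt : (∫⁻ t in Ioo a T, ENNReal.ofReal ((T - t) ^ (-s))) < ⊤ := lt_top_iff_ne_top.2 hne
  have hmeas : AEStronglyMeasurable (fun t : ℝ => (T - t) ^ (-s)) (volume.restrict (Ioo a T)) :=
    ((measurable_const.sub measurable_id).pow_const (-s)).aestronglyMeasurable
  have hnn : 0 ≤ᵐ[volume.restrict (Ioo a T)] fun t : ℝ => (T - t) ^ (-s) :=
    (ae_restrict_mem measurableSet_Ioo).mono fun t ht => Real.rpow_nonneg (sub_pos.2 ht.2).le _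
  have hint : IntegrableOn (fun t : ℝ => (T - t) ^ (-s)) (Ioo a T) volume :=
    ⟨hmeas, (hasFiniteIntegral_iff_ofReal hnn).2 hlt⟩
  have h1 : IntervalIntegrable (fun t : ℝ => (T - t) ^ (-s)) volume a T :=
    (intervalIntegrable_iff_integrableOn_Ioo_of_le haT.le).2 hint
  have h2 : IntervalIntegrable (fun x : ℝ => x ^ (-s)) volume 0 (T - a) := by
    have := (h1.comp_sub_left T).symm
    simpa only [sub_sub_cancel, sub_self] using this
  have h3 : IntegrableOn (fun x : ℝ => x ^ (-s)) (Ioo 0 (T - a)) volume :=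
    (intervalIntegrable_iff_integrableOn_Ioo_of_le (sub_pos.2 haT).le).1 h2
  have h4 := (intervalIntegral.integrableOn_Ioo_rpow_iff (sub_pos.2 haT)).1 h3
  linarith

/-- **Registered stub `stub_floorToDivergence` (PROVED).**  If `‖u(t)‖₃ ≥ c (T-t)^{-θ₀}` on `(T₁,T)` with `c > 0`,
`q ≥ 0`, `q θ₀ ≥ 1`, then `∫⁻_{(T₂,T)} ‖u(t)‖₃^q dt = ∞` for every `T₂ < T`. -/
theorem stub_floorToDivergence :
    ∀ (T θ₀ q c T₁ : ℝ) (u : ℝ → (EuclideanSpace ℝ (Fin 3)) → (EuclideanSpace ℝ (Fin 3))), 0 < c → 0 ≤ q → 1 ≤ q * θ₀ → T₁ < T →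
      (∀ t ∈ Ioo T₁ T, ENNReal.ofReal (c * (T - t) ^ (-θ₀)) ≤ eLpNorm (u t) 3 volume) →
      ∀ T₂ < T, (∫⁻ t in Ioo T₂ T, eLpNorm (u t) 3 volume ^ q) = ⊤ := by
  intro T θ₀ q c T₁ u hc hq hqθ hT₁T hfloor T₂ hT₂T
  set a : ℝ := max T₁ T₂ with ha
  have haT : a < T := max_lt hT₁T hT₂T
  -- pointwise on `(a,T)`: `‖u(t)‖₃^q ≥ c^q (T-t)^{-(qθ₀)}`
  have hpt : ∀ t ∈ Ioo a T,
      ENNReal.ofReal (c ^ q) * ENNReal.ofReal ((T - t) ^ (-(q * θ₀))) ≤ eLpNorm (u t) 3 volume ^ q := by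
    intro t ht
    have hs : 0 < T - t := sub_pos.2 ht.2
    have ht₁ : t ∈ Ioo T₁ T := ⟨lt_of_le_of_lt (le_max_left _ _) ht.1, ht.2⟩
    have h1 : ENNReal.ofReal (c * (T - t) ^ (-θ₀)) ^ q ≤ eLpNorm (u t) 3 volume ^ q :=
      ENNReal.rpow_le_rpow (hfloor t ht₁) hq
    have h2 : ENNReal.ofReal (c * (T - t) ^ (-θ₀)) ^ q =
        ENNReal.ofReal (c ^ q) * ENNReal.ofReal ((T - t) ^ (-(q * θ₀))) := by
      rw [ENNReal.ofReal_rpow_of_nonneg (mul_nonneg hc.le (Real.rpow_nonneg hs.le _)) hq,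
        Real.mul_rpow hc.le (Real.rpow_nonneg hs.le _), ← Real.rpow_mul hs.le,
        ENNReal.ofReal_mul (Real.rpow_nonneg hc.le _)]
      congr 3
      ring
    rw [← h2]
    exact h1
  have hmono : (∫⁻ t in Ioo a T, ENNReal.ofReal (c ^ q) * ENNReal.ofReal ((T - t) ^ (-(q * θ₀)))) ≤
      ∫⁻ t in Ioo T₂ T, eLpNorm (u t) 3 volume ^ q :=
    (lintegral_mono_ae ((ae_restrict_mem measurableSet_Ioo).mono fun t ht => hpt t ht)).trans
      (lintegral_mono_set (Ioo_subset_Ioo_left (le_max_right _ _)))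
  rw [lintegral_const_mul' _ _ ENNReal.ofReal_ne_top, lintegral_Ioo_ofReal_rpow_neg_eq_top haT hqθ,
    ENNReal.mul_top (by simpa using Real.rpow_pos_of_pos hc q)] at hmono
  exact eq_top_iff.2 hmono

end Summit.NavierStokesRegularity.NavierStokesRegularity.Cruxes.SupercriticalSerrinL3.RateFloor

end
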